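import Summits.HodgeConjecture.HodgeConjecture.Theorems.F0P3cStCharTSJacCartanWeight        -- ★ WEIGHT-DOCK 1∕2 (LH6-p04): `tau_add`, `tau_sub`, `tau_smul`, `tau_tau`, `map_smul_eq` (the semilinear involution `τ`)
import Summits.HodgeConjecture.HodgeConjecture.Theorems.F0P3cStCharTSCartanDecompositionAd  -- ★ (Q8∕C7 kit): `mem_ker_adSubOne_iff`, `isCompl_ker_range_adSubOne` (`M_n(K) = 𝔷(t) ⊕ (Ad t − 1)M_n(K)`)
import Literature.NumberTheory.Weil1982.UnitaryFinCayleyWindow                             -- ★ `cayley`, `cayley_def`, `cayley_neg`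
import HarnessLib

/-!
# R90-TF · S4 (Ch. 13.1–2) · road (J̃♭) «TWISTED TUBE JACOBIAN», FILE (TJ1): THE ALGEBRAIC HEART — the twisted linear part `Ad(b⁻¹) + τ`, the semilinear operator
# `S = τ ∘ Ad(b⁻¹)`, `S² = Ad(N(b)⁻¹)`, `(S − 1)(S + 1) = Ad(N(b)⁻¹) − 1`, the `θ`-conjugation `S(θX) = −θ S X`, and `ε(cayley X) = cayley(−τ X)` (field level, no measures)

Dealt by the S4 dealer (K2E2-plan (g7), 01:54:29Z, deliverable (J1)); census `R90/R90-C131-p04/g2/CENSUS-Jtilde.md` §2.  Crux H413 `stmt-HodgeConjecture-24833`, lane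
`--supports … --as helper` (count-neutral).  THEOREMS ONLY — no `def`, no instance, no notation, no named-fact hypothesis, no `sorry`; ★-only imports.

SETTING (one local field `K = L_w ⊃ L⁺_v`, read through p04's one-place model ★ `R90S4EpsSingularNull` §3; here ANY field `K`, `σ : K →+* K` an involution, `J ∈ M_n(K)`
hermitian invertible).  `τ X := J⁻¹ (X.map σ)ᵀ J` — the `σ`-semilinear involution of `M_n(K)` of ★ WEIGHT-DOCK (`tau_tau`), ANTI-multiplicative (§1 `tau_mul`); the twist of
`G̃ = GL_n(K)` is `ε(g) = J⁻¹ ((g⁻¹).map σ)ᵀ J = τ(g⁻¹)` (★ `twistLocal_apply` read at `w`: `Φ_v⁻¹ ((σ g)ᵀ)⁻¹ Φ_v`), and the norm is `N(b) = b ε(b) = b τ(b⁻¹)`.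
THE HEART (census §2).  In the Cayley chart at `b` the twisted tube `(x, y) ↦ x (b y) ε(x)⁻¹` has linear part `L_ε = Ad(b⁻¹) + τ` on the moving space `𝔪 = (Ad N − 1)M_n(K)`
(`dε = −τ` by §5 `tau_cayley_inv`: `ε(c(X)) = c(−τX)`), identity on `𝔷 = 𝔷(N)`; with `S X := τ(b⁻¹ X b)`:
* §2 `tau_conj` `τ(g X g⁻¹) = τ(g⁻¹) τ(X) τ(g)` (= `Ad(ε g) τ X`);  `S_apply` `S X = τ(b) τ(X) τ(b⁻¹)`;  **`S_S`** `S (S X) = N⁻¹ X N` with `N = b τ(b⁻¹)`, `N⁻¹ = τ(b) b⁻¹`;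
  **`S_sub_one_comp_S_add_one`** `S (S X + X) − (S X + X) = N⁻¹ X N − X` — the product `(S − 1)(S + 1)` IS the regularised operator `Ad(N⁻¹) − 1` of ★ C7
  `det_eq_neg_discr_div_det_sq` on `𝔪`, whose `K`-determinant is `−disc χ_N ∕ det N²`;  `S_smul` `S(θ • X) = σ θ • S X` (so `θ • (1 + S) • θ⁻¹ = 1 − S` for `σ θ = −θ`);
  `L_eq_tau_comp` `b⁻¹ X b + τ X = τ (S X + X)` (`L_ε|_𝔪 = τ ∘ (1 + S)`).
* §3 (`b ε(b) = ε(b) b`): `tau_N_inv` `τ(N⁻¹) = N` (`ε N = N`), `tau_N` `τ N = N⁻¹`, `b_mul_N` `b N = N b`.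
* §4 STABILITY of `𝔷(N) = {X | X N = N X}` and `𝔪 = range(Ad N − 1)` (★ `CartanDecompositionAd` currency `mulLeftRight K (N, N⁻¹) − id`) under `τ`, `Ad(b⁻¹)`, `S`, `θ •`.
* §5 `tau_inv` `τ(A⁻¹) = (τ A)⁻¹`, **`tau_cayley_inv`** `τ((cayley X)⁻¹) = cayley(−τ X)` i.e. `ε(c(X)) = c(dε X)` with `dε = −τ`.
CONSEQUENCE (file (TJ3), measure level): `χ(L_ε)² = χ((S−1)(S+1)) = ‖det_K(Ad N⁻¹ − 1 | 𝔪)‖_K = ‖−disc χ_N ∕ det N²‖_K`, i.e. `χ(L_ε) = cartanWeight (N b)` = print's `D_G(N δ)²`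
[Rogawski1990 §12.5 p. 186] — the dealer's «`det(1 − Ad δ ∘ dε | 𝔤̃∕𝔱̃) = det(1 − Ad N δ | 𝔤̃∕𝔱̃)`» in the tree's `addEquivAddHaarChar` calculus.

HONEST LABEL: HC_CM is proved only modulo the 7 printed citations (2 remaining named inputs: hLiu418 = stmt-HodgeConjecture-24832, h413 = stmt-HodgeConjecture-24833)
until rung 0 closes.  Pure algebra toward the OPEN (J̃♭) input of (B1); pays no socket.

## References
* [Rogawski1990] J. Rogawski, *Automorphic Representations of Unitary Groups in Three Variables*, Ann. of Math. Stud. 123 (1990), §12.5 p. 186 (twisted Weyl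
  integration formula, weight `D_G(N(δ))²`), §3.11 p. 34 (`ε`, `N`), §4.10 p. 57.
* [Labesse1999] J.-P. Labesse, *Cohomologie, stabilisation et changement de base*, Astérisque 257 (1999), §III.1 (twisted Jacobian `|det(1 − Ad(δ)θ | 𝔤∕𝔤_{δθ})|`).
* [HarishChandra1970] Harish-Chandra, *Harmonic analysis on reductive p-adic groups*, LNM 162 (1970), Lemma 22.
* [PlatonovRapinchuk1994] V. Platonov, A. Rapinchuk, *Algebraic Groups and Number Theory* (1994), §3.3 (Cayley transform).
-/

set_option autoImplicit false
-- the mandated namespace repeats the single-problem summit's segment (`HodgeConjecture.HodgeConjecture`)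
set_option linter.dupNamespace false

noncomputable section

open Matrix
open Summit.HodgeConjecture.HodgeConjecture.Cruxes.H413
open Summit.HodgeConjecture.HodgeConjecture.Cruxes.H413.F0P3cStCharTSJacCartanWeight (map_smul_eq tau_add tau_sub tau_smul tau_tau)
open Literature.NumberTheory.Weil1982.UnitaryFinTopForm (cayley cayley_def cayley_neg)
open scoped MatrixGroups

namespace Summit.HodgeConjecture.HodgeConjecture.R90.S4

variable {K : Type*} [Field K] (σ : K →+* K) {n : Type*} [Fintype n] [DecidableEq n] (J : Matrix n n K)

/-! ## §1 `τ` is a unital anti-homomorphism -/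

/-- `τ 1 = 1` (`J⁻¹ J = 1`). [cite: PlatonovRapinchuk1994, §3.3] -/
theorem tau_one (hJ : IsUnit J.det) : J⁻¹ * ((1 : Matrix n n K).map σ)ᵀ * J = 1 := by
  rw [Matrix.map_one σ (map_zero σ) (map_one σ), Matrix.transpose_one, Matrix.mul_one, Matrix.nonsing_inv_mul J hJ]

/-- **`τ` is ANTI-multiplicative**: `τ(X Y) = τ Y · τ X`. [cite: PlatonovRapinchuk1994, §3.3] -/
theorem tau_mul (hJ : IsUnit J.det) (X Y : Matrix n n K) :
    J⁻¹ * ((X * Y).map σ)ᵀ * J = (J⁻¹ * (Y.map σ)ᵀ * J) * (J⁻¹ * (X.map σ)ᵀ * J) := by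
  rw [Matrix.map_mul, Matrix.transpose_mul]
  calc J⁻¹ * ((Y.map σ)ᵀ * (X.map σ)ᵀ) * J = J⁻¹ * (Y.map σ)ᵀ * (J * J⁻¹) * (X.map σ)ᵀ * J := by
        rw [Matrix.mul_nonsing_inv J hJ, Matrix.mul_one]; noncomm_ring
    _ = (J⁻¹ * (Y.map σ)ᵀ * J) * (J⁻¹ * (X.map σ)ᵀ * J) := by noncomm_ring

/-- `τ(A⁻¹) = (τ A)⁻¹` for invertible `A`. [cite: PlatonovRapinchuk1994, §3.3] -/
theorem tau_inv (hJ : IsUnit J.det) {A : Matrix n n K} (hA : IsUnit A.det) :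
    J⁻¹ * ((A⁻¹).map σ)ᵀ * J = (J⁻¹ * (A.map σ)ᵀ * J)⁻¹ := by
  have h : (J⁻¹ * ((A⁻¹).map σ)ᵀ * J) * (J⁻¹ * (A.map σ)ᵀ * J) = 1 := by
    rw [← tau_mul σ J hJ, Matrix.mul_nonsing_inv A hA, tau_one σ J hJ]
  exact (Matrix.inv_eq_left_inv h).symm

/-- `τ(↑g⁻¹) · τ(↑g) = 1` for `g ∈ GL_n(K)` (so `τ(↑g) = ε(g)⁻¹` with `ε g = τ(↑g⁻¹)`). [cite: Rogawski1990, §3.11 p. 34] -/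
theorem tau_coe_inv_mul_tau_coe (hJ : IsUnit J.det) (g : GL n K) :
    (J⁻¹ * (((g⁻¹ : GL n K) : Matrix n n K).map σ)ᵀ * J) * (J⁻¹ * ((g : Matrix n n K).map σ)ᵀ * J) = 1 := by
  rw [← tau_mul σ J hJ, ← Units.val_mul, mul_inv_cancel, Units.val_one, tau_one σ J hJ]

/-- `τ(↑g) · τ(↑g⁻¹) = 1`. [cite: Rogawski1990, §3.11 p. 34] -/
theorem tau_coe_mul_tau_coe_inv (hJ : IsUnit J.det) (g : GL n K) :
    (J⁻¹ * ((g : Matrix n n K).map σ)ᵀ * J) * (J⁻¹ * (((g⁻¹ : GL n K) : Matrix n n K).map σ)ᵀ * J) = 1 := by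
  rw [← tau_mul σ J hJ, ← Units.val_mul, inv_mul_cancel, Units.val_one, tau_one σ J hJ]

/-! ## §2 The semilinear operator `S = τ ∘ Ad(b⁻¹)` and the product identity -/

/-- **`τ ∘ Ad(g) = Ad(ε g) ∘ τ`**: `τ(g X g⁻¹) = τ(g⁻¹) · τ X · τ(g)`. [cite: Rogawski1990, §3.11 p. 34] [cite: Labesse1999, §III.1] -/
theorem tau_conj (hJ : IsUnit J.det) (g : GL n K) (X : Matrix n n K) :
    J⁻¹ * (((g : Matrix n n K) * X * ((g⁻¹ : GL n K) : Matrix n n K)).map σ)ᵀ * J =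
      (J⁻¹ * (((g⁻¹ : GL n K) : Matrix n n K).map σ)ᵀ * J) * (J⁻¹ * (X.map σ)ᵀ * J) * (J⁻¹ * ((g : Matrix n n K).map σ)ᵀ * J) := by
  rw [tau_mul σ J hJ, tau_mul σ J hJ]
  simp only [Matrix.mul_assoc]

/-- `S X := τ(b⁻¹ X b) = τ(b) · τ X · τ(b⁻¹)`. [cite: Labesse1999, §III.1] -/
theorem S_apply (hJ : IsUnit J.det) (b : GL n K) (X : Matrix n n K) :
    J⁻¹ * ((((b⁻¹ : GL n K) : Matrix n n K) * X * (b : Matrix n n K)).map σ)ᵀ * J =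
      (J⁻¹ * ((b : Matrix n n K).map σ)ᵀ * J) * (J⁻¹ * (X.map σ)ᵀ * J) * (J⁻¹ * (((b⁻¹ : GL n K) : Matrix n n K).map σ)ᵀ * J) := by
  have h := tau_conj σ J hJ b⁻¹ X
  rw [inv_inv] at h
  exact h

/-- `S` is additive. [cite: Labesse1999, §III.1] -/
theorem S_add (b : GL n K) (X Y : Matrix n n K) :
    J⁻¹ * ((((b⁻¹ : GL n K) : Matrix n n K) * (X + Y) * (b : Matrix n n K)).map σ)ᵀ * J =
      J⁻¹ * ((((b⁻¹ : GL n K) : Matrix n n K) * X * (b : Matrix n n K)).map σ)ᵀ * J +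
        J⁻¹ * ((((b⁻¹ : GL n K) : Matrix n n K) * Y * (b : Matrix n n K)).map σ)ᵀ * J := by
  rw [Matrix.mul_add, Matrix.add_mul, tau_add]

/-- **`S` is `σ`-SEMILINEAR**: `S(c • X) = σ c • S X`; at a skew element (`σ θ = −θ`) this is the conjugation `θ • (1 + S) • θ⁻¹ = 1 − S` used by the weight file.
[cite: Labesse1999, §III.1] -/
theorem S_smul (b : GL n K) (c : K) (X : Matrix n n K) :
    J⁻¹ * ((((b⁻¹ : GL n K) : Matrix n n K) * (c • X) * (b : Matrix n n K)).map σ)ᵀ * J =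
      σ c • (J⁻¹ * ((((b⁻¹ : GL n K) : Matrix n n K) * X * (b : Matrix n n K)).map σ)ᵀ * J) := by
  rw [Matrix.mul_smul, Matrix.smul_mul, tau_smul]

/-- `S(θ • X) = −(θ • S X)` for `σ θ = −θ`. [cite: Labesse1999, §III.1] -/
theorem S_smul_of_skew (b : GL n K) {θ : K} (hθ : σ θ = -θ) (X : Matrix n n K) :
    J⁻¹ * ((((b⁻¹ : GL n K) : Matrix n n K) * (θ • X) * (b : Matrix n n K)).map σ)ᵀ * J =
      -(θ • (J⁻¹ * ((((b⁻¹ : GL n K) : Matrix n n K) * X * (b : Matrix n n K)).map σ)ᵀ * J)) := by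
  rw [S_smul, hθ, neg_smul]

/-- **`S ∘ S = Ad(N⁻¹)`** with `N = b · τ(↑b⁻¹)` (`= b ε(b)`, the norm) and `N⁻¹ = τ(↑b) · b⁻¹`: `S (S X) = (τ(b) b⁻¹) X (b τ(b⁻¹))` (`τ` an involution: `σ² = id`,
`J` hermitian). [cite: Rogawski1990, §3.11 p. 34] [cite: Labesse1999, §III.1] -/
theorem S_S (hJ : IsUnit J.det) (hJh : (J.map σ)ᵀ = J) (hσ2 : ∀ a, σ (σ a) = a) (b : GL n K) (X : Matrix n n K) :
    J⁻¹ * ((((b⁻¹ : GL n K) : Matrix n n K) * (J⁻¹ * ((((b⁻¹ : GL n K) : Matrix n n K) * X * (b : Matrix n n K)).map σ)ᵀ * J) * (b : Matrix n n K)).map σ)ᵀ * J =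
      (J⁻¹ * ((b : Matrix n n K).map σ)ᵀ * J) * ((b⁻¹ : GL n K) : Matrix n n K) * X *
        ((b : Matrix n n K) * (J⁻¹ * (((b⁻¹ : GL n K) : Matrix n n K).map σ)ᵀ * J)) := by
  rw [S_apply σ J hJ b X, S_apply σ J hJ b,
    tau_mul σ J hJ ((J⁻¹ * ((b : Matrix n n K).map σ)ᵀ * J) * (J⁻¹ * (X.map σ)ᵀ * J)) (J⁻¹ * (((b⁻¹ : GL n K) : Matrix n n K).map σ)ᵀ * J),
    tau_mul σ J hJ (J⁻¹ * ((b : Matrix n n K).map σ)ᵀ * J) (J⁻¹ * (X.map σ)ᵀ * J),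
    tau_tau σ J hJ hJh hσ2 X, tau_tau σ J hJ hJh hσ2 (b : Matrix n n K), tau_tau σ J hJ hJh hσ2 ((b⁻¹ : GL n K) : Matrix n n K)]
  noncomm_ring

/-- **THE PRODUCT IDENTITY `(S − 1) ∘ (S + 1) = Ad(N⁻¹) − 1`**: `S (S X + X) − (S X + X) = N⁻¹ X N − X` — on the moving space `𝔪 = (Ad N − 1)M_n(K)` this is the
regularised operator of ★ C7 `det_eq_neg_discr_div_det_sq` (determinant `−disc χ_N ∕ det N²`). [cite: Labesse1999, §III.1] [cite: HarishChandra1970, Lemma 22] -/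
theorem S_sub_one_comp_S_add_one (hJ : IsUnit J.det) (hJh : (J.map σ)ᵀ = J) (hσ2 : ∀ a, σ (σ a) = a) (b : GL n K) (X : Matrix n n K) :
    J⁻¹ * ((((b⁻¹ : GL n K) : Matrix n n K) *
          (J⁻¹ * ((((b⁻¹ : GL n K) : Matrix n n K) * X * (b : Matrix n n K)).map σ)ᵀ * J + X) * (b : Matrix n n K)).map σ)ᵀ * J -
        (J⁻¹ * ((((b⁻¹ : GL n K) : Matrix n n K) * X * (b : Matrix n n K)).map σ)ᵀ * J + X) =
      (J⁻¹ * ((b : Matrix n n K).map σ)ᵀ * J) * ((b⁻¹ : GL n K) : Matrix n n K) * X *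
          ((b : Matrix n n K) * (J⁻¹ * (((b⁻¹ : GL n K) : Matrix n n K).map σ)ᵀ * J)) - X := by
  rw [S_add, S_S σ J hJ hJh hσ2]
  abel

/-- **`L_ε|_𝔪 = τ ∘ (1 + S)`**: `τ (S X + X) = b⁻¹ X b + τ X` (`τ ∘ S = Ad(b⁻¹)` by `τ ∘ τ = id`). [cite: Labesse1999, §III.1] -/
theorem L_eq_tau_comp (hJ : IsUnit J.det) (hJh : (J.map σ)ᵀ = J) (hσ2 : ∀ a, σ (σ a) = a) (b : GL n K) (X : Matrix n n K) :
    J⁻¹ * ((J⁻¹ * ((((b⁻¹ : GL n K) : Matrix n n K) * X * (b : Matrix n n K)).map σ)ᵀ * J + X).map σ)ᵀ * J =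
      ((b⁻¹ : GL n K) : Matrix n n K) * X * (b : Matrix n n K) + J⁻¹ * (X.map σ)ᵀ * J := by
  rw [tau_add, tau_tau σ J hJ hJh hσ2]

/-! ## §3 The norm `N = b ε(b)` under `b ε(b) = ε(b) b` -/

section Norm

variable {σ J}

/-- `τ N = N⁻¹`: `τ(b · τ(↑b⁻¹)) = τ(↑b) · b⁻¹` when `b τ(↑b⁻¹) = τ(↑b⁻¹) b`. [cite: Rogawski1990, §3.11 p. 34] -/
theorem tau_N (hJ : IsUnit J.det) (hJh : (J.map σ)ᵀ = J) (hσ2 : ∀ a, σ (σ a) = a) (b : GL n K)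
    (hcomm : (b : Matrix n n K) * (J⁻¹ * (((b⁻¹ : GL n K) : Matrix n n K).map σ)ᵀ * J) = (J⁻¹ * (((b⁻¹ : GL n K) : Matrix n n K).map σ)ᵀ * J) * (b : Matrix n n K)) :
    J⁻¹ * (((b : Matrix n n K) * (J⁻¹ * (((b⁻¹ : GL n K) : Matrix n n K).map σ)ᵀ * J)).map σ)ᵀ * J =
      (J⁻¹ * ((b : Matrix n n K).map σ)ᵀ * J) * ((b⁻¹ : GL n K) : Matrix n n K) := by
  rw [hcomm, tau_mul σ J hJ, tau_tau σ J hJ hJh hσ2]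

/-- **`ε N = N`**, i.e. `τ(N⁻¹) = N`: `τ(τ(↑b) · b⁻¹) = b · τ(↑b⁻¹)` when `b ε(b) = ε(b) b`. [cite: Rogawski1990, §3.11 p. 34] -/
theorem tau_N_inv (hJ : IsUnit J.det) (hJh : (J.map σ)ᵀ = J) (hσ2 : ∀ a, σ (σ a) = a) (b : GL n K)
    (hcomm : (b : Matrix n n K) * (J⁻¹ * (((b⁻¹ : GL n K) : Matrix n n K).map σ)ᵀ * J) = (J⁻¹ * (((b⁻¹ : GL n K) : Matrix n n K).map σ)ᵀ * J) * (b : Matrix n n K)) :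
    J⁻¹ * (((J⁻¹ * ((b : Matrix n n K).map σ)ᵀ * J) * ((b⁻¹ : GL n K) : Matrix n n K)).map σ)ᵀ * J =
      (b : Matrix n n K) * (J⁻¹ * (((b⁻¹ : GL n K) : Matrix n n K).map σ)ᵀ * J) := by
  rw [tau_mul σ J hJ, tau_tau σ J hJ hJh hσ2, ← hcomm]

/-- `N · N⁻¹ = 1` for `N = b τ(↑b⁻¹)`, `N⁻¹ = τ(↑b) b⁻¹`. [cite: Rogawski1990, §3.11 p. 34] -/
theorem N_mul_N_inv (hJ : IsUnit J.det) (b : GL n K) :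
    ((b : Matrix n n K) * (J⁻¹ * (((b⁻¹ : GL n K) : Matrix n n K).map σ)ᵀ * J)) * ((J⁻¹ * ((b : Matrix n n K).map σ)ᵀ * J) * ((b⁻¹ : GL n K) : Matrix n n K)) = 1 := by
  calc ((b : Matrix n n K) * (J⁻¹ * (((b⁻¹ : GL n K) : Matrix n n K).map σ)ᵀ * J)) * ((J⁻¹ * ((b : Matrix n n K).map σ)ᵀ * J) * ((b⁻¹ : GL n K) : Matrix n n K))
        = (b : Matrix n n K) * ((J⁻¹ * (((b⁻¹ : GL n K) : Matrix n n K).map σ)ᵀ * J) * (J⁻¹ * ((b : Matrix n n K).map σ)ᵀ * J)) * ((b⁻¹ : GL n K) : Matrix n n K) := by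
          noncomm_ring
    _ = 1 := by rw [tau_coe_inv_mul_tau_coe σ J hJ, Matrix.mul_one, ← Units.val_mul, mul_inv_cancel, Units.val_one]

/-- `N⁻¹ · N = 1`. [cite: Rogawski1990, §3.11 p. 34] -/
theorem N_inv_mul_N (hJ : IsUnit J.det) (b : GL n K) :
    ((J⁻¹ * ((b : Matrix n n K).map σ)ᵀ * J) * ((b⁻¹ : GL n K) : Matrix n n K)) * ((b : Matrix n n K) * (J⁻¹ * (((b⁻¹ : GL n K) : Matrix n n K).map σ)ᵀ * J)) = 1 := by
  calc ((J⁻¹ * ((b : Matrix n n K).map σ)ᵀ * J) * ((b⁻¹ : GL n K) : Matrix n n K)) * ((b : Matrix n n K) * (J⁻¹ * (((b⁻¹ : GL n K) : Matrix n n K).map σ)ᵀ * J))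
        = (J⁻¹ * ((b : Matrix n n K).map σ)ᵀ * J) * (((b⁻¹ : GL n K) : Matrix n n K) * (b : Matrix n n K)) * (J⁻¹ * (((b⁻¹ : GL n K) : Matrix n n K).map σ)ᵀ * J) := by
          noncomm_ring
    _ = 1 := by rw [← Units.val_mul, inv_mul_cancel, Units.val_one, Matrix.mul_one, tau_coe_mul_tau_coe_inv σ J hJ]

/-- `b N = N b` when `b ε(b) = ε(b) b`. [cite: Rogawski1990, §3.11 p. 34] -/
theorem b_mul_N (b : GL n K)
    (hcomm : (b : Matrix n n K) * (J⁻¹ * (((b⁻¹ : GL n K) : Matrix n n K).map σ)ᵀ * J) = (J⁻¹ * (((b⁻¹ : GL n K) : Matrix n n K).map σ)ᵀ * J) * (b : Matrix n n K)) :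
    (b : Matrix n n K) * ((b : Matrix n n K) * (J⁻¹ * (((b⁻¹ : GL n K) : Matrix n n K).map σ)ᵀ * J)) =
      ((b : Matrix n n K) * (J⁻¹ * (((b⁻¹ : GL n K) : Matrix n n K).map σ)ᵀ * J)) * (b : Matrix n n K) := by
  conv_lhs => rw [hcomm]
  simp only [Matrix.mul_assoc]

end Norm

/-! ## §4 Stability of `𝔷(N)` and `𝔪 = (Ad N − 1) M_n(K)` under `τ`, `Ad(b⁻¹)` and `θ •` -/

section Stability

variable {σ J}

/-- **`τ` preserves the commutant `𝔷(N)`** (`ε N = N`): `X N = N X ⇒ τX · N = N · τX`. [cite: HarishChandra1970, Lemma 22] [cite: Labesse1999, §III.1] -/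
theorem tau_mem_commutant (hJ : IsUnit J.det) {N X : Matrix n n K} (hN : IsUnit N.det)
    (hτN : J⁻¹ * (N.map σ)ᵀ * J = N⁻¹) (hX : X * N = N * X) :
    (J⁻¹ * (X.map σ)ᵀ * J) * N = N * (J⁻¹ * (X.map σ)ᵀ * J) := by
  have h : J⁻¹ * ((X * N).map σ)ᵀ * J = J⁻¹ * ((N * X).map σ)ᵀ * J := by rw [hX]
  rw [tau_mul σ J hJ X N, tau_mul σ J hJ N X, hτN] at h
  -- `h : N⁻¹ * τX = τX * N⁻¹`
  calc (J⁻¹ * (X.map σ)ᵀ * J) * N = (N * N⁻¹) * (J⁻¹ * (X.map σ)ᵀ * J) * N := by rw [Matrix.mul_nonsing_inv N hN, Matrix.one_mul]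
    _ = N * (N⁻¹ * (J⁻¹ * (X.map σ)ᵀ * J)) * N := by simp only [Matrix.mul_assoc]
    _ = N * ((J⁻¹ * (X.map σ)ᵀ * J) * N⁻¹) * N := by rw [h]
    _ = N * (J⁻¹ * (X.map σ)ᵀ * J) * (N⁻¹ * N) := by simp only [Matrix.mul_assoc]
    _ = N * (J⁻¹ * (X.map σ)ᵀ * J) := by rw [Matrix.nonsing_inv_mul N hN, Matrix.mul_one]

/-- **`τ` preserves the moving space**: `τ(N Y N⁻¹ − Y) = N (τ Y') N⁻¹ − Y'`-shaped, precisely `τ(N Y N⁻¹ − Y) = N · τY · N⁻¹ − τY` when `τ(N⁻¹) = N`, `τ N = N⁻¹`.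
[cite: HarishChandra1970, Lemma 22] [cite: Labesse1999, §III.1] -/
theorem tau_adSubOne (hJ : IsUnit J.det) {N Y : Matrix n n K}
    (hτN : J⁻¹ * (N.map σ)ᵀ * J = N⁻¹) (hτNinv : J⁻¹ * ((N⁻¹).map σ)ᵀ * J = N) :
    J⁻¹ * ((N * Y * N⁻¹ - Y).map σ)ᵀ * J = N * (J⁻¹ * (Y.map σ)ᵀ * J) * N⁻¹ - J⁻¹ * (Y.map σ)ᵀ * J := by
  rw [tau_sub, tau_mul σ J hJ, tau_mul σ J hJ, hτN, hτNinv]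
  simp only [Matrix.mul_assoc]

/-- `Ad(b⁻¹)` preserves the moving space: `b⁻¹ (N Y N⁻¹ − Y) b = N (b⁻¹ Y b) N⁻¹ − b⁻¹ Y b` when `b N = N b`. [cite: HarishChandra1970, Lemma 22] -/
theorem conj_adSubOne (b : GL n K) {N : Matrix n n K} (hN : IsUnit N.det) (hbN : (b : Matrix n n K) * N = N * (b : Matrix n n K)) (Y : Matrix n n K) :
    ((b⁻¹ : GL n K) : Matrix n n K) * (N * Y * N⁻¹ - Y) * (b : Matrix n n K) =
      N * (((b⁻¹ : GL n K) : Matrix n n K) * Y * (b : Matrix n n K)) * N⁻¹ - ((b⁻¹ : GL n K) : Matrix n n K) * Y * (b : Matrix n n K) := by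
  have hbinv : ((b⁻¹ : GL n K) : Matrix n n K) * N = N * ((b⁻¹ : GL n K) : Matrix n n K) := by
    have h := congrArg (fun Z => ((b⁻¹ : GL n K) : Matrix n n K) * Z * ((b⁻¹ : GL n K) : Matrix n n K)) hbN
    rw [← Matrix.mul_assoc, ← Matrix.mul_assoc, ← Units.val_mul, inv_mul_cancel, Units.val_one, Matrix.one_mul, Matrix.mul_assoc, Matrix.mul_assoc,
      ← Units.val_mul, mul_inv_cancel, Units.val_one, Matrix.mul_one] at h
    exact h.symm
  have hNinv : N⁻¹ * (b : Matrix n n K) = (b : Matrix n n K) * N⁻¹ := by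
    calc N⁻¹ * (b : Matrix n n K) = N⁻¹ * (b : Matrix n n K) * (N * N⁻¹) := by rw [Matrix.mul_nonsing_inv N hN, Matrix.mul_one]
      _ = N⁻¹ * ((b : Matrix n n K) * N) * N⁻¹ := by simp only [Matrix.mul_assoc]
      _ = N⁻¹ * (N * (b : Matrix n n K)) * N⁻¹ := by rw [hbN]
      _ = (N⁻¹ * N) * (b : Matrix n n K) * N⁻¹ := by simp only [Matrix.mul_assoc]
      _ = (b : Matrix n n K) * N⁻¹ := by rw [Matrix.nonsing_inv_mul N hN, Matrix.one_mul]
  rw [Matrix.mul_sub, Matrix.sub_mul]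
  congr 1
  calc ((b⁻¹ : GL n K) : Matrix n n K) * (N * Y * N⁻¹) * (b : Matrix n n K)
        = (((b⁻¹ : GL n K) : Matrix n n K) * N) * Y * (N⁻¹ * (b : Matrix n n K)) := by noncomm_ring
    _ = (N * ((b⁻¹ : GL n K) : Matrix n n K)) * Y * ((b : Matrix n n K) * N⁻¹) := by rw [hbinv, hNinv]
    _ = N * (((b⁻¹ : GL n K) : Matrix n n K) * Y * (b : Matrix n n K)) * N⁻¹ := by noncomm_ring

/-- `Ad(b⁻¹)` preserves the commutant: `X N = N X ⇒ (b⁻¹ X b) N = N (b⁻¹ X b)` when `b N = N b`. [cite: HarishChandra1970, Lemma 22] -/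
theorem conj_mem_commutant (b : GL n K) {N X : Matrix n n K} (hbN : (b : Matrix n n K) * N = N * (b : Matrix n n K)) (hX : X * N = N * X) :
    (((b⁻¹ : GL n K) : Matrix n n K) * X * (b : Matrix n n K)) * N = N * (((b⁻¹ : GL n K) : Matrix n n K) * X * (b : Matrix n n K)) := by
  have hbinv : ((b⁻¹ : GL n K) : Matrix n n K) * N = N * ((b⁻¹ : GL n K) : Matrix n n K) := by
    have h := congrArg (fun Z => ((b⁻¹ : GL n K) : Matrix n n K) * Z * ((b⁻¹ : GL n K) : Matrix n n K)) hbN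
    rw [← Matrix.mul_assoc, ← Matrix.mul_assoc, ← Units.val_mul, inv_mul_cancel, Units.val_one, Matrix.one_mul, Matrix.mul_assoc, Matrix.mul_assoc,
      ← Units.val_mul, mul_inv_cancel, Units.val_one, Matrix.mul_one] at h
    exact h.symm
  calc (((b⁻¹ : GL n K) : Matrix n n K) * X * (b : Matrix n n K)) * N = ((b⁻¹ : GL n K) : Matrix n n K) * X * ((b : Matrix n n K) * N) := by noncomm_ring
    _ = ((b⁻¹ : GL n K) : Matrix n n K) * (X * N) * (b : Matrix n n K) := by rw [hbN]; noncomm_ring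
    _ = (((b⁻¹ : GL n K) : Matrix n n K) * N) * X * (b : Matrix n n K) := by rw [hX]; noncomm_ring
    _ = N * (((b⁻¹ : GL n K) : Matrix n n K) * X * (b : Matrix n n K)) := by rw [hbinv]; noncomm_ring

omit [DecidableEq n] in
/-- Scalars preserve the commutant: `X N = N X ⇒ (c • X) N = N (c • X)`. [cite: HarishChandra1970, Lemma 22] -/
theorem smul_mem_commutant (c : K) {N X : Matrix n n K} (hX : X * N = N * X) : (c • X) * N = N * (c • X) := by
  rw [Matrix.smul_mul, Matrix.mul_smul, hX]

/-- Scalars preserve the moving space: `c • (N Y N⁻¹ − Y) = N (c • Y) N⁻¹ − c • Y`. [cite: HarishChandra1970, Lemma 22] -/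
theorem smul_adSubOne (c : K) (N Y : Matrix n n K) : c • (N * Y * N⁻¹ - Y) = N * (c • Y) * N⁻¹ - c • Y := by
  rw [smul_sub, Matrix.mul_smul, Matrix.smul_mul]

/-- The moving space in ★ `CartanDecompositionAd`'s currency: `X ∈ range (Ad_N − 1) ↔ ∃ Y, X = N Y N⁻¹ − Y` (`N ∈ GL_n(K)`). [cite: HarishChandra1970, Lemma 22] -/
theorem mem_range_adSubOne_iff (N : GL n K) (X : Matrix n n K) :
    X ∈ LinearMap.range (LinearMap.mulLeftRight K ((N : Matrix n n K), ((N⁻¹ : GL n K) : Matrix n n K)) - LinearMap.id : Matrix n n K →ₗ[K] Matrix n n K) ↔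
      ∃ Y : Matrix n n K, X = (N : Matrix n n K) * Y * ((N⁻¹ : GL n K) : Matrix n n K) - Y := by
  simp only [LinearMap.mem_range, LinearMap.sub_apply, LinearMap.mulLeftRight_apply, LinearMap.id_apply]
  exact ⟨fun ⟨Y, hY⟩ => ⟨Y, hY.symm⟩, fun ⟨Y, hY⟩ => ⟨Y, hY.symm⟩⟩

end Stability

/-! ## §5 The twist and the Cayley transform: `ε(c(X)) = c(−τ X)`, i.e. `dε = −τ` -/

section Cayley

variable {σ J}

/-- `(1 + Y)⁻¹ (1 − Y) = (1 − Y)(1 + Y)⁻¹` (the two factors commute). [cite: PlatonovRapinchuk1994, §3.3] -/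
theorem one_add_inv_mul_one_sub {Y : Matrix n n K} (hp : IsUnit (1 + Y).det) : (1 + Y)⁻¹ * (1 - Y) = (1 - Y) * (1 + Y)⁻¹ := by
  have hc : (1 - Y) * (1 + Y) = (1 + Y) * (1 - Y) := by noncomm_ring
  calc (1 + Y)⁻¹ * (1 - Y) = (1 + Y)⁻¹ * (1 - Y) * ((1 + Y) * (1 + Y)⁻¹) := by rw [Matrix.mul_nonsing_inv _ hp, Matrix.mul_one]
    _ = (1 + Y)⁻¹ * ((1 - Y) * (1 + Y)) * (1 + Y)⁻¹ := by noncomm_ring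
    _ = (1 + Y)⁻¹ * ((1 + Y) * (1 - Y)) * (1 + Y)⁻¹ := by rw [hc]
    _ = ((1 + Y)⁻¹ * (1 + Y)) * (1 - Y) * (1 + Y)⁻¹ := by noncomm_ring
    _ = (1 - Y) * (1 + Y)⁻¹ := by rw [Matrix.nonsing_inv_mul _ hp, Matrix.one_mul]

/-- `τ(1 + X) = 1 + τ X` and `τ(1 − X) = 1 − τ X`. [cite: PlatonovRapinchuk1994, §3.3] -/
theorem tau_one_add (hJ : IsUnit J.det) (X : Matrix n n K) : J⁻¹ * ((1 + X).map σ)ᵀ * J = 1 + J⁻¹ * (X.map σ)ᵀ * J := by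
  rw [tau_add, tau_one σ J hJ]

/-- `τ(1 − X) = 1 − τ X`. [cite: PlatonovRapinchuk1994, §3.3] -/
theorem tau_one_sub (hJ : IsUnit J.det) (X : Matrix n n K) : J⁻¹ * ((1 - X).map σ)ᵀ * J = 1 - J⁻¹ * (X.map σ)ᵀ * J := by
  rw [tau_sub, tau_one σ J hJ]

/-- **`ε(c(X)) = c(−τ X)`** — the twist of a Cayley transform is the Cayley transform of `dε X = −τ X`: `τ((cayley X)⁻¹) = cayley (−τ X)` whenever `1 ± X` and
`1 + τ X` are invertible (`(cayley X)⁻¹ = (1 − X)(1 + X)⁻¹`, `τ` a unital anti-homomorphism).  The twisted tube map in the Cayley chart therefore has ★ C8b-core's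
shape with third slot `τ`. [cite: PlatonovRapinchuk1994, §3.3] [cite: Labesse1999, §III.1] -/
theorem tau_cayley_inv (hJ : IsUnit J.det) {X : Matrix n n K} (hm : IsUnit (1 - X).det) (hp : IsUnit (1 + X).det)
    (hpτ : IsUnit (1 + J⁻¹ * (X.map σ)ᵀ * J).det) :
    J⁻¹ * (((cayley X)⁻¹).map σ)ᵀ * J = cayley (-(J⁻¹ * (X.map σ)ᵀ * J)) := by
  have hinv : (cayley X)⁻¹ = (1 - X) * (1 + X)⁻¹ := by
    have h1 : (1 - X) * (1 + X)⁻¹ * cayley X = 1 := by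
      rw [cayley_def]
      calc (1 - X) * (1 + X)⁻¹ * ((1 + X) * (1 - X)⁻¹) = (1 - X) * ((1 + X)⁻¹ * (1 + X)) * (1 - X)⁻¹ := by noncomm_ring
        _ = 1 := by rw [Matrix.nonsing_inv_mul _ hp, Matrix.mul_one, Matrix.mul_nonsing_inv _ hm]
    exact Matrix.inv_eq_left_inv h1
  rw [hinv, tau_mul σ J hJ, tau_inv σ J hJ hp, tau_one_add hJ X, tau_one_sub hJ X, cayley_neg, one_add_inv_mul_one_sub hpτ]

end Cayley

end Summit.HodgeConjecture.HodgeConjecture.R90.S4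

end
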